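import Summits.BirchSwinnertonDyer.BirchSwinnertonDyer.Theorems.ByReductionTypeAtTwoSupersingularFlatZetaProportional
import Summits.BirchSwinnertonDyer.BirchSwinnertonDyer.Theorems.ByReductionTypeAtTwoSupersingularFlatZetaDivisible
import Summits.BirchSwinnertonDyer.BirchSwinnertonDyer.Theorems.ByReductionTypeAtTwoSupersingularFlatColemanSprungBridge
import Literature.NumberTheory.EllipticCurves.IwasawaAlgebraStructureProofs
import Literature.NumberTheory.EllipticCurves.IwasawaAlgebraSpecializationCoprimeProofs
import Literature.NumberTheory.EllipticCurves.CongrModOmegaOfValuesProofs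
import Literature.AnabelianGeometry.EtaleTheta.RootsOfUnityGaloisPrimePower
import HarnessLib

/-!
# Route `ByReductionTypeAtTwo` (rung K4), crux `SupersingularRankZeroAtTwo` (item stmt-BirchSwinnertonDyer-19097), line
# `odd_blind_package` v2.19, stub 3/5 `stub_flatPackage`, conjunct (8), clause F3 — **FILE Z4 of hand hF3-ZETA: DIVISION BY THE
# CUSP MULTIPLIERS** — from the levelwise congruences «`A_δ·θ̃_n ≡ d·P_{n,c_n}(L x_δ) (mod ω_n)`» for a coprime family and its
# generator `s₀` (`A_δ • s₀ = x_δ`), the congruence «`θ̃_n ≡ ν·P_{n,c_n}(L s₀) (mod ω_n)`» FOR `s₀`, hence `hPS` for `ν • s₀` and —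
# through the Coleman–Sprung bridge p830158 — `ν · Col♭(L s₀) = L♭` ON THE NOSE (cell `bsd-2adic`, seat `bsd-2adic-t42` GEN 51;
# `--supports 19097`, helper)

HONEST FRAMING (D-0054): THEOREMS ONLY — no definition, no named fact, no instance, no `sorry`.  CONSUMER algebra: the congruences
(tower-1's hand hF3-ERL, file E3) and the coprimality of the multipliers (K3's cusp brick at the primes `∌ 2`) are DISPLAYED hypotheses.
Helper toward conjunct (8) F3; closes NO stub; 19097 stays OPEN on its 5 registered stubs; nothing booked; BSD₂ is proved for no
supersingular curve and BSD for no curve by any of this; typed ≠ proved.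

## What and why («division at torsion points», done in `Λ`)

Dividing the congruence `A_δ·θ̃_n ≡ d·A_δ·P_n(L s₀) (mod ω_n)` by `A_δ` is legitimate at the `2ⁿ`-th roots of unity `ζ` with `A_δ(ζ−1) ≠ 0`;
coprimality of `(A_δ)_δ` at the height-one primes `(T)`, `(Φ_{2^k}(1+T))` (all `∌ 2`) says every `ζ` has such a `δ`.  In `Λ` this is the
squarefree factorisation `ω_n = T·∏_{k≤n} Φ_{2^k}(1+T)` into PRIME ELEMENTS (Eisenstein + Weierstrass; tree `IwasawaAlgebra.isPrime_span_coe`,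
`irreducible_cyclotomic_prime_pow_comp_padicInt`): «`ω_n ∣ A_δ·E` for all `δ` ⇒ `ω_n ∣ E`» by induction on `n` (§2), no `ℂ₂`-values needed.
* §1 `prime_coe_cyclotomic_comp` (any `p`; the tree's private `Sprung2012.prime_toIwasawa_cyclotomic_comp` made public in substance),
  `not_coe_cyclotomic_comp_dvd_C`, `not_X_dvd_C`, `toIwasawa_cyclotomicOmega_zero/succ`.
* §2 ★ `omega_dvd_of_forall_dvd_mul_of_coprime` (any `p`).
* §3 ★ `thetaCongruence_of_family` (any `p`, any `Θ ∈ ℚ_p⟦T⟧` with bounded denominators, i.e. `C(p^a)·Θ ∈ ι Λ`): the E3-shaped family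
  congruences + `ω_n ∣ P_δ − A_δ·P₀` ⇒ `∃ m q, C(p^m)·(Θ − ι(C d·P₀)) = ι(ω_n q)`.
* §4 (the pin data; `p`-generic): ★★ `congr_mazurTate_smul_of_family` — with `P_δ := P_{n,c_n}(L x_δ)`, `x_δ = A_δ • s₀`, `Θ_n := θ_n^{ℚ_p}`:
  `∀ n, IsCongrModOmega p n (C 1 · mazurTateElement f p n) 1 (P_{n,c_n}(L (ν • s₀)))`; ★★ `mul_coleman_eq_of_family` — through the
  bridge p830158: `ι (J (L (ν • s₀))).2 = ι L♭`, i.e. `ν · Col♭(L s₀) = L♭` in `Λ` — with `ν = C d` EXACTLY the `hCol` of file Z5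
  `flatF3_package_of_mul_coleman_eq` (the multiplier `ν` is tower-1's `C(D·q.den)`; `d ∈ ℤ_p`).

References: [Kato2004Asterisque] K. Kato, Astérisque 295 (2004), Thm. 12.5 (1), Thm. 12.6 (pp. 221–222), §13.9 (p. 230), §13.12 (pp. 231–233),
Thm. 16.6; [Washington1997] §7.1 (Thm. 7.1, Prop. 7.2), Lemma 13.7, §13.2; [SerreLocalFields1979] IV §4 Prop. 17; [Sprung2017] Thm. 1.12,
Cor. 4.4; [Pollack2003] Prop. 6.18.
-/

set_option autoImplicit false
-- the Theorems namespace of this sub repeats the summit name by design (D-0017 nested layout)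
set_option linter.dupNamespace false

noncomputable section

open scoped Classical NumberField

open Polynomial

universe u

namespace Summit.BirchSwinnertonDyer.BirchSwinnertonDyer.Theorems

namespace SSFlatPackage

open Literature.NumberTheory.EllipticCurves Literature.NumberTheory.EllipticCurves.ZpExtension
  Literature.NumberTheory.EllipticCurves.Sprung2017 Literature.NumberTheory.EllipticCurves.Sprung2012
  Literature.NumberTheory.EllipticCurves.Kobayashi2003 Literature.NumberTheory.GaloisRepresentations CongruenceSubgroup

/-! ## §1 The prime factors of `ω_n` in `Λ = ℤ_p⟦T⟧` -/

section Lambda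

variable {p : ℕ} [hp : Fact p.Prime]

/-- **`Φ_{p^{k+1}}(1+T)` is a prime element of `Λ = ℤ_p⟦T⟧`** (distinguished — Eisenstein at `p` — and irreducible over `ℤ_p`; Weierstrass
division: `IwasawaAlgebra.isPrime_span_coe`).  (The tree's `Sprung2012.ColemanOrbitLayerTwoProofs` proves this privately; same proof.)
[cite: Washington1997, §7.1 and §13.2] [cite: SerreLocalFields1979, IV §4 Prop. 17] -/
theorem prime_coe_cyclotomic_comp (k : ℕ) :
    Prime ((((cyclotomic (p ^ (k + 1)) ℤ).comp (X + 1)).map (Int.castRingHom ℤ_[p]) : ℤ_[p][X]) : IwasawaAlgebra p) := by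
  -- adapted from Literature/NumberTheory/EllipticCurves/Sprung2012/ColemanOrbitLayerTwoProofs.lean (private lemma)
  have hmonic : ((cyclotomic (p ^ (k + 1)) ℤ).comp (X + 1)).Monic :=
    (cyclotomic.monic _ ℤ).comp (monic_X_add_C 1) (by rw [← C_1, natDegree_X_add_C]; exact one_ne_zero)
  have hdist : (((cyclotomic (p ^ (k + 1)) ℤ).comp (X + 1)).map (Int.castRingHom ℤ_[p])).IsDistinguishedAt
      (IsLocalRing.maximalIdeal ℤ_[p]) :=
    { toIsWeaklyEisensteinAt :=
        (Literature.AnabelianGeometry.EtaleTheta.cyclotomic_prime_pow_comp_X_add_one_isEisensteinAt_padicInt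
          p k).isWeaklyEisensteinAt
      monic := hmonic.map _ }
  have hI := IwasawaAlgebra.isPrime_span_coe (p := p) hdist
    (Literature.AnabelianGeometry.EtaleTheta.irreducible_cyclotomic_prime_pow_comp_padicInt p k)
  have hne := IwasawaAlgebra.coe_ne_zero_of_monic (p := p) (hmonic.map (Int.castRingHom ℤ_[p]))
  exact (Ideal.span_singleton_prime hne).mp hI

/-- `Φ_{p^{k+1}}(1+T) ∤ p` in `Λ` (a monic polynomial is relatively prime to `p`; a prime is not a unit). [cite: Washington1997, Lemma 13.7] -/
theorem not_coe_cyclotomic_comp_dvd_C (k : ℕ) :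
    ¬ ((((cyclotomic (p ^ (k + 1)) ℤ).comp (X + 1)).map (Int.castRingHom ℤ_[p]) : ℤ_[p][X]) : IwasawaAlgebra p) ∣
      PowerSeries.C (p : ℤ_[p]) := by
  intro h
  have hrel := IwasawaAlgebra.isRelPrime_C_pow_coe_of_monic p (IwasawaAlgebra.monic_cyclotomic_comp p k) 1
  rw [pow_one] at hrel
  exact (prime_coe_cyclotomic_comp k).not_unit (hrel h (dvd_refl _))

/-- `T ∤ p` in `Λ` (constant coefficient). [cite: Washington1997, §7.1] -/
theorem not_X_dvd_C : ¬ (PowerSeries.X : IwasawaAlgebra p) ∣ PowerSeries.C (p : ℤ_[p]) := by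
  intro h
  rw [PowerSeries.X_dvd_iff, PowerSeries.constantCoeff_C] at h
  exact hp.out.ne_zero (by exact_mod_cast h)

/-- `ω_0 = T`. [cite: Washington1997, §7.1 Thm. 7.1] -/
theorem toIwasawa_cyclotomicOmega_zero : toIwasawa p (cyclotomicOmega p 0) = PowerSeries.X := by
  rw [toIwasawa_cyclotomicOmega, pow_zero, pow_one, add_sub_cancel_left]

/-- `ω_{n+1} = ω_n · Φ_{p^{n+1}}(1+T)` in `Λ`. [cite: Washington1997, §7.1 Thm. 7.1] -/
theorem toIwasawa_cyclotomicOmega_succ (n : ℕ) :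
    toIwasawa p (cyclotomicOmega p (n + 1)) = toIwasawa p (cyclotomicOmega p n) *
      ((((cyclotomic (p ^ (n + 1)) ℤ).comp (X + 1)).map (Int.castRingHom ℤ_[p]) : ℤ_[p][X]) : IwasawaAlgebra p) := by
  rw [cyclotomicOmega_succ, map_mul]
  rfl

/-! ## §2 «`ω_n ∣ A_δ·E` for every `δ` of a coprime family ⇒ `ω_n ∣ E`» -/

/-- ★ **Division by a coprime family modulo `ω_n`.**  If `(A_δ)` misses every height-one prime `𝔭 ∌ p` of `Λ` (the cusp-brick
coprimality) and `ω_n ∣ A_δ·E` for every `δ`, then `ω_n ∣ E` — induction on `n` along `ω_{n+1} = ω_n·Φ_{p^{n+1}}(1+T)`, each factor being a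
prime element generating a height-one prime `∌ p`.  This is «division at the torsion points `ζ − 1`, `ζ^{pⁿ} = 1`» carried out in `Λ`.
[cite: Kato2004Asterisque, §13.9 (p. 230) and §13.12 (pp. 231–233)] [cite: Washington1997, §7.1 Thm. 7.1, §13.2] -/
theorem omega_dvd_of_forall_dvd_mul_of_coprime {ι : Type*} (A : ι → IwasawaAlgebra p)
    (hcop : ∀ 𝔭 : PrimeSpectrum (IwasawaAlgebra p), 𝔭.asIdeal.height = 1 →
      PowerSeries.C (p : ℤ_[p]) ∉ 𝔭.asIdeal → ∃ i, A i ∉ 𝔭.asIdeal) :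
    ∀ (n : ℕ) {E : IwasawaAlgebra p}, (∀ i, toIwasawa p (cyclotomicOmega p n) ∣ A i * E) →
      toIwasawa p (cyclotomicOmega p n) ∣ E := by
  have hprime := forall_prime_exists_not_dvd_of_forall_heightOne_not_mem A (PowerSeries.C (p : ℤ_[p])) hcop
  -- one prime factor at a time
  have step : ∀ {π E : IwasawaAlgebra p}, Prime π → ¬ π ∣ PowerSeries.C (p : ℤ_[p]) → (∀ i, π ∣ A i * E) → π ∣ E := by
    intro π E hπ hπp h
    obtain ⟨i, hi⟩ := hprime π hπ hπp
    exact ((hπ.dvd_or_dvd (h i)).resolve_left hi)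
  intro n
  induction n with
  | zero =>
    intro E h
    rw [toIwasawa_cyclotomicOmega_zero] at h ⊢
    exact step PowerSeries.X_prime not_X_dvd_C h
  | succ n ih =>
    intro E h
    have hω : ∀ i, toIwasawa p (cyclotomicOmega p n) ∣ A i * E := fun i ↦
      (Dvd.intro _ (toIwasawa_cyclotomicOmega_succ n).symm).trans (h i)
    obtain ⟨E', rfl⟩ := ih hω
    rw [toIwasawa_cyclotomicOmega_succ]
    refine mul_dvd_mul_left _ (step (prime_coe_cyclotomic_comp n) (not_coe_cyclotomic_comp_dvd_C n) fun i ↦ ?_)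
    have hne : toIwasawa p (cyclotomicOmega p n) ≠ 0 :=
      IwasawaAlgebra.coe_ne_zero_of_monic (p := p) ((monic_cyclotomicOmega p n).map (Int.castRingHom ℤ_[p]))
    have h' := h i
    rw [toIwasawa_cyclotomicOmega_succ, show A i * (toIwasawa p (cyclotomicOmega p n) * E') =
      toIwasawa p (cyclotomicOmega p n) * (A i * E') by ring] at h'
    exact (mul_dvd_mul_iff_left hne).mp h'

/-! ## §3 The division step in `Λ ⊗ ℚ_p` -/

/-- ★ **From the family congruences to the congruence for the generator.**  Data: `Θ ∈ ℚ_p⟦T⟧` with `C(p^a)·Θ = ι Θ₀` (bounded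
denominators — any `θ^{ℚ_p}` of a polynomial `θ ∈ ℚ[T]`), `ν ∈ Λ`, multipliers `A_δ` coprime at the height-one primes `∌ p`, elements
`P_δ, P₀ ∈ Λ` with `ω_n ∣ P_δ − A_δ·P₀` (the pairing sums of `x_δ = A_δ • s₀` and of `s₀`, file Z2 §1).  If every `δ` satisfies the E3-shaped
congruence `C(p^m)·(ι A_δ·Θ − ι(ν·P_δ)) = ι(ω_n q)`, then `C(p^m)·(Θ − ι(ν·P₀)) = ι(ω_n q)` for some `m, q`.
[cite: Kato2004Asterisque, Thm. 12.5 (1) (p. 222), §13.9 (p. 230)] [cite: Pollack2003, Prop. 6.18 (shape)] -/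
theorem thetaCongruence_of_family {ι : Type*} (A : ι → IwasawaAlgebra p)
    (hcop : ∀ 𝔭 : PrimeSpectrum (IwasawaAlgebra p), 𝔭.asIdeal.height = 1 →
      PowerSeries.C (p : ℤ_[p]) ∉ 𝔭.asIdeal → ∃ i, A i ∉ 𝔭.asIdeal)
    (n : ℕ) (Θ : PowerSeries ℚ_[p]) {a : ℕ} {Θ₀ : IwasawaAlgebra p}
    (hΘ : PowerSeries.C ((p : ℚ_[p]) ^ a) * Θ = iwasawaToPowerSeries p Θ₀) (ν : IwasawaAlgebra p)
    {P : ι → IwasawaAlgebra p} {P₀ : IwasawaAlgebra p}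
    (hP : ∀ i, toIwasawa p (cyclotomicOmega p n) ∣ P i - A i * P₀)
    (hE3 : ∀ i, ∃ (m : ℕ) (q : IwasawaAlgebra p), PowerSeries.C ((p : ℚ_[p]) ^ m) *
        (iwasawaToPowerSeries p (A i) * Θ - iwasawaToPowerSeries p (ν * P i)) =
      iwasawaToPowerSeries p ((((cyclotomicOmega p n).map (Int.castRingHom ℤ_[p]) : ℤ_[p][X]) : PowerSeries ℤ_[p]) * q)) :
    ∃ (m : ℕ) (q : IwasawaAlgebra p), PowerSeries.C ((p : ℚ_[p]) ^ m) *
        (Θ - iwasawaToPowerSeries p (ν * P₀)) =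
      iwasawaToPowerSeries p ((((cyclotomicOmega p n).map (Int.castRingHom ℤ_[p]) : ℤ_[p][X]) : PowerSeries ℤ_[p]) * q) := by
  set Ω : IwasawaAlgebra p := (((cyclotomicOmega p n).map (Int.castRingHom ℤ_[p]) : ℤ_[p][X]) : PowerSeries ℤ_[p]) with hΩ
  have hΩ' : toIwasawa p (cyclotomicOmega p n) = Ω := rfl
  -- the integral element `E := Θ₀ − p^a·ν·P₀` is divisible by `A_δ` times `ω_n` for every `δ`
  set E : IwasawaAlgebra p := Θ₀ - PowerSeries.C ((p : ℤ_[p]) ^ a) * (ν * P₀) with hE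
  have hdiv : ∀ i, Ω ∣ A i * E := by
    intro i
    obtain ⟨m, q, e⟩ := hE3 i
    -- integral form of the E3 congruence: `p^m·(A_i Θ₀ − p^a ν P_i) = ω_n (p^a q)`
    have key : iwasawaToPowerSeries p (PowerSeries.C ((p : ℤ_[p]) ^ m) *
        (A i * Θ₀ - PowerSeries.C ((p : ℤ_[p]) ^ a) * (ν * P i))) =
        iwasawaToPowerSeries p (Ω * (PowerSeries.C ((p : ℤ_[p]) ^ a) * q)) := by
      simp only [map_mul, map_sub, iwasawaToPowerSeries_C_natCast_pow, ← hΘ]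
      simp only [map_mul] at e
      linear_combination (PowerSeries.C ((p : ℚ_[p]) ^ a)) * e
    have h1 : Ω ∣ PowerSeries.C ((p : ℤ_[p]) ^ m) * (A i * Θ₀ - PowerSeries.C ((p : ℤ_[p]) ^ a) * (ν * P i)) := by
      rw [iwasawaToPowerSeries_injective p key]
      exact dvd_mul_right Ω _
    have h2 : Ω ∣ A i * Θ₀ - PowerSeries.C ((p : ℤ_[p]) ^ a) * (ν * P i) := by
      rw [← hΩ'] at h1 ⊢
      exact omega_dvd_of_dvd_C_pow_mul h1
    have h3 : Ω ∣ PowerSeries.C ((p : ℤ_[p]) ^ a) * ν * (P i - A i * P₀) :=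
      (hΩ' ▸ hP i) |> fun h ↦ Dvd.dvd.mul_left h _
    have e4 : A i * E = (A i * Θ₀ - PowerSeries.C ((p : ℤ_[p]) ^ a) * (ν * P i)) +
        PowerSeries.C ((p : ℤ_[p]) ^ a) * ν * (P i - A i * P₀) := by
      rw [hE]; ring
    rw [e4]
    exact dvd_add h2 h3
  obtain ⟨q, hq⟩ := omega_dvd_of_forall_dvd_mul_of_coprime A hcop n (E := E) (by rw [hΩ']; exact hdiv)
  refine ⟨a, q, ?_⟩
  rw [mul_sub, hΘ, ← hΩ', ← hq, hE]
  simp only [map_sub, map_mul, iwasawaToPowerSeries_C_natCast_pow]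

end Lambda

/-! ## §4 The pin data: `hPS` for `ν • s₀` and `ν · Col♭(L s₀) = L♭` -/

section Pin

variable {K : Type u} [Field K] {p : ℕ} [hp : Fact p.Prime] {κ : ZpExtension K p}
variable {E : Type u} [Field E] [Algebra K E] {ι' : AlgebraicClosure K →ₐ[K] AlgebraicClosure E}
variable {W : WeierstrassCurve K}

/-- `(C 1 · θ)^{ℚ_p} = θ^{ℚ_p}`. [folklore] -/
theorem coe_map_C_one_mul (θ : ℚ[X]) :
    ((Polynomial.map (algebraMap ℚ ℚ_[p]) (Polynomial.C (1 : ℚ) * θ) : ℚ_[p][X]) : PowerSeries ℚ_[p]) =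
      ((θ.map (algebraMap ℚ ℚ_[p]) : ℚ_[p][X]) : PowerSeries ℚ_[p]) := by
  rw [map_one, one_mul]

/-- ★★ **`hPS` FOR `ν • s₀` FROM THE FAMILY CONGRUENCES.**  Pin data: `H` any `Λ`-module (meant `𝐇¹ = I.H`), `Λ`-linear
`L : H → H¹_Iw` for `(a_p, g, c)` (`p ∣ a_p`, levels, traces), a family `x_δ = A_δ • s₀` with `(A_δ)` coprime at the height-one primes
`∌ p`, a multiplier `ν ∈ Λ` (tower-1: `ν = C(D·q.den)`), and tower-1's E3 congruences against `θ̃_n = (mazurTateElement f p n)^{ℚ_p}` for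
every `δ` and `n` (hypothesis `hE3` = E3's conclusion LITERALLY, pen RC-834 relay, with `μ := A δ`, `w := L (x δ)`).  Then
`∀ n, IsCongrModOmega p n (C 1 · θ_n) 1 (P_{n,c_n}(L (ν • s₀)))` — the bridge's `hPS` with `ϖ = 1` for the class `ν • s₀ ∈ Λ∙s₀`.
[cite: Kato2004Asterisque, Thm. 12.5 (1) (p. 222), §13.9, §13.12 (pp. 230–233)] [cite: Sprung2017, Cor. 4.4] [cite: Pollack2003, Prop. 6.18] -/
theorem congr_mazurTate_smul_of_family {g : Field.absoluteGaloisGroup E} (hg : κ.IsTopGenerator (resGalOfEmb ι' g))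
    {ap : ℤ} (hap : (p : ℤ) ∣ ap) {c : ℕ → localPoints W E} (hcn : ∀ k, c k ∈ localLayerPointsOfEmb κ ι' W k)
    (htr : ∀ n, 1 ≤ n → localTraceOfEmb κ ι' W n (n + 1) (c (n + 1)) = ap • c n - c (n - 1))
    {H : Type*} [AddCommGroup H] [Module (IwasawaAlgebra p) H]
    (L : letI := moduleOfGenerator κ ι' W hg; H →ₗ[IwasawaAlgebra p] (localTowerPointsOfEmb κ ι' W →+ ℤ_[p]))
    {ι : Type*} (A : ι → IwasawaAlgebra p) (x : ι → H) (s₀ : H) (hs₀ : ∀ i, A i • s₀ = x i)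
    (hcop : ∀ 𝔭 : PrimeSpectrum (IwasawaAlgebra p), 𝔭.asIdeal.height = 1 →
      PowerSeries.C (p : ℤ_[p]) ∉ 𝔭.asIdeal → ∃ i, A i ∉ 𝔭.asIdeal)
    {N : ℕ} (f : CuspForm (Gamma0 N) 2) (ν : IwasawaAlgebra p)
    (hE3 : ∀ (i : ι) (n : ℕ), ∃ (m : ℕ) (q : IwasawaAlgebra p), PowerSeries.C ((p : ℚ_[p]) ^ m) *
        (iwasawaToPowerSeries p (A i) * (((mazurTateElement f p n).map (algebraMap ℚ ℚ_[p]) : ℚ_[p][X]) : PowerSeries ℚ_[p]) -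
          iwasawaToPowerSeries p (ν * pairingSum W (localTowerPointsOfEmb κ ι' W) g n (c n) (L (x i)))) =
      iwasawaToPowerSeries p ((((cyclotomicOmega p n).map (Int.castRingHom ℤ_[p]) : ℤ_[p][X]) : PowerSeries ℤ_[p]) * q)) :
    letI := moduleOfGenerator κ ι' W hg
    ∀ n : ℕ, IsCongrModOmega p n (Polynomial.C (1 : ℚ) * mazurTateElement f p n) 1
      (pairingSum W (localTowerPointsOfEmb κ ι' W) g n (c n) (L (ν • s₀))) := by
  letI := moduleOfGenerator κ ι' W hg
  intro n
  -- bounded denominators of `θ_n`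
  obtain ⟨a, Θ₀, hΘ⟩ := exists_C_pow_mul_coe_eq_iwasawaToPowerSeries (p := p) ((mazurTateElement f p n).map (algebraMap ℚ ℚ_[p]))
  -- `ω_n ∣ P_n(L x_i) − A_i · P_n(L s₀)`
  have hP : ∀ i, toIwasawa p (cyclotomicOmega p n) ∣
      pairingSum W (localTowerPointsOfEmb κ ι' W) g n (c n) (L (x i)) -
        A i * pairingSum W (localTowerPointsOfEmb κ ι' W) g n (c n) (L s₀) := by
    intro i
    rw [← hs₀ i, map_smul]
    exact omega_dvd_pairingSum_smul_sub hg hap hcn htr (A i) (L s₀) n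
  obtain ⟨m, q, e⟩ := thetaCongruence_of_family A hcop n _ hΘ ν hP (fun i ↦ hE3 i n)
  -- `ω_n ∣ P_n(L (ν • s₀)) − ν · P_n(L s₀)`
  obtain ⟨r, hr⟩ : ∃ r, pairingSum W (localTowerPointsOfEmb κ ι' W) g n (c n) (L (ν • s₀)) -
      ν * pairingSum W (localTowerPointsOfEmb κ ι' W) g n (c n) (L s₀) = toIwasawa p (cyclotomicOmega p n) * r := by
    rw [map_smul]
    exact omega_dvd_pairingSum_smul_sub hg hap hcn htr ν (L s₀) n
  refine ⟨m, q - PowerSeries.C ((p : ℤ_[p]) ^ m) * r, ?_⟩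
  rw [coe_map_C_one_mul, coe_map_one, one_mul, eq_add_of_sub_eq hr, toIwasawa_cyclotomicOmega_eq_coe_map]
  simp only [map_add, map_mul, map_sub, iwasawaToPowerSeries_C_natCast_pow] at e ⊢
  linear_combination e

/-- ★★ **`ν · Col♭(L s₀) = L♭` FROM THE FAMILY CONGRUENCES** (and `ν · Col♯(L s₀) = L♯`), for a `Λ`-linear `J` carrying the Coleman
values: the Coleman–Sprung bridge p830158 applied to `hPS` for `ν • s₀` with `ϖ = 1`, read back in `Λ` (`ι` injective).  With
`ν = C d` this is EXACTLY the hypothesis `hCol` of file Z5 `flatF3_package_of_mul_coleman_eq`; with `t = ϖ·d ∈ ℤ₂` ((B1)) and the ZL2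
clause of file Z3 it yields F3a ∧ F3b ∧ ZL2 of conjunct (8). [cite: Kato2004Asterisque, Thm. 12.5 (1)(4) (p. 222), §13.12 (pp. 231–233), Thm. 16.6]
[cite: Sprung2017, Thm. 1.12, Cor. 4.4–4.5] [cite: Sprung2012, Prop. 5.7, Def. 5.9 (p. 1495), Def. 7.1 (p. 1500)] -/
theorem mul_coleman_eq_of_family {g : Field.absoluteGaloisGroup E} (hg : κ.IsTopGenerator (resGalOfEmb ι' g))
    {ap : ℤ} (hap : (p : ℤ) ∣ ap) {c : ℕ → localPoints W E} (hcn : ∀ k, c k ∈ localLayerPointsOfEmb κ ι' W k)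
    (htr : ∀ n, 1 ≤ n → localTraceOfEmb κ ι' W n (n + 1) (c (n + 1)) = ap • c n - c (n - 1))
    {H : Type*} [AddCommGroup H] [Module (IwasawaAlgebra p) H]
    (L : letI := moduleOfGenerator κ ι' W hg; H →ₗ[IwasawaAlgebra p] (localTowerPointsOfEmb κ ι' W →+ ℤ_[p]))
    (J : letI := moduleOfGenerator κ ι' W hg
      (localTowerPointsOfEmb κ ι' W →+ ℤ_[p]) →ₗ[IwasawaAlgebra p] IwasawaAlgebra p × IwasawaAlgebra p)
    (hJ : ∀ w, IsColemanPair κ ι' W ap g c w (J w).1 (J w).2)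
    {ι : Type*} (A : ι → IwasawaAlgebra p) (x : ι → H) (s₀ : H) (hs₀ : ∀ i, A i • s₀ = x i)
    (hcop : ∀ 𝔭 : PrimeSpectrum (IwasawaAlgebra p), 𝔭.asIdeal.height = 1 →
      PowerSeries.C (p : ℤ_[p]) ∉ 𝔭.asIdeal → ∃ i, A i ∉ 𝔭.asIdeal)
    {N : ℕ} (f : CuspForm (Gamma0 N) 2) {Lsharp Lflat : IwasawaAlgebra p} (hLf : IsSprungPair f p ap Lsharp Lflat)
    (ν : IwasawaAlgebra p)
    (hE3 : ∀ (i : ι) (n : ℕ), ∃ (m : ℕ) (q : IwasawaAlgebra p), PowerSeries.C ((p : ℚ_[p]) ^ m) *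
        (iwasawaToPowerSeries p (A i) * (((mazurTateElement f p n).map (algebraMap ℚ ℚ_[p]) : ℚ_[p][X]) : PowerSeries ℚ_[p]) -
          iwasawaToPowerSeries p (ν * pairingSum W (localTowerPointsOfEmb κ ι' W) g n (c n) (L (x i)))) =
      iwasawaToPowerSeries p ((((cyclotomicOmega p n).map (Int.castRingHom ℤ_[p]) : ℤ_[p][X]) : PowerSeries ℤ_[p]) * q)) :
    ν * (J (L s₀)).1 = Lsharp ∧ ν * (J (L s₀)).2 = Lflat := by
  letI := moduleOfGenerator κ ι' W hg
  have hPS := congr_mazurTate_smul_of_family hg hap hcn htr L A x s₀ hs₀ hcop f ν hE3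
  obtain ⟨hs, hf⟩ := iwasawaToPowerSeries_coleman_eq_C_mul_of_congr_mazurTate κ ι' W hap (hJ (L (ν • s₀))) f hLf 1 hPS
  rw [map_smul, map_smul, Rat.cast_one, map_one, one_mul] at hs hf
  rw [Prod.smul_fst, smul_eq_mul] at hs
  rw [Prod.smul_snd, smul_eq_mul] at hf
  exact ⟨iwasawaToPowerSeries_injective p hs, iwasawaToPowerSeries_injective p hf⟩

end Pin

end SSFlatPackage

end Summit.BirchSwinnertonDyer.BirchSwinnertonDyer.Theorems

end
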